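import Summits.CriticalPhenomena.PercolationContinuityZ3.Theorems.PercNearOneGluingNoHeavyLowerTailSahiThreeChainsBridgePolar
import Summits.CriticalPhenomena.PercolationContinuityZ3.Theorems.PercNearOneGluingNoHeavyLowerTailSahiThreeChainsBridgeSets
import Summits.CriticalPhenomena.PercolationContinuityZ3.Theorems.PercNearOneGluingNoHeavyLowerTailSahiThreeChainsCheckA
import Summits.CriticalPhenomena.PercolationContinuityZ3.Theorems.PercNearOneGluingNoHeavyLowerTailSahiThreeChainsCheckB
import Summits.CriticalPhenomena.PercolationContinuityZ3.Theorems.PercNearOneGluingNoHeavyLowerTailSahiThreeChainsCheckC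
import Summits.CriticalPhenomena.PercolationContinuityZ3.Theorems.PercNearOneGluingNoHeavyLowerTailSahiThreeChainsCheckD

/-!
# `NoHeavyLowerTail` (crux stmt-CriticalPhenomena-4575), Sahi programme (prim-master-conj gen 40): BRIDGE B, part 2 — from orbit sums
# to the finite kernel, and **Sahi's `E₃ ≥ 0` on every product of three finite chains under every product probability weight**

Support file (`--supports stmt-CriticalPhenomena-4575`; COMPUTATIONAL through the imported blocks `checkBlock_A…D`).

* `psi`, `pull` — for a triple `t` of points of `Fin m₁ × Fin m₂ × Fin m₃`, the sorted coordinate maps `[3] → Fin m_k` (`Tuple.sort`) and the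
  pulled-back subsets of the grid `Q = Fin 3 × Fin 3 × Fin 3`; `isUpperSet_pull` (monotone pull-back of an up-set is an up-set);
  `orbitSum_eq_latinSum` — `Σ_π G_{abc}(π·t) = Σ_ρ G_{ã b̃ c̃}(ρ·diag)` (re-index `π = σρ` by the sorting permutations);
* `toMask`, `testBit_toMask`, `isUp3_toMask` — encoding of subsets of `Q` as bitmasks (cell `(i,j,k) ↦ i + 3j + 9k`), up-sets go to `IsUp3`;
* `latinSum_eq_sum_phi` — `Σ_ρ G_{ã b̃ c̃}(ρ·diag) = Σ_{u ∈ ã} φ_{toMask b̃, toMask c̃}(code u)` (group the 216 Latin triples by their first point;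
  the fibres are the 8 Latin partners of `…SahiThreeChainsCert.latinNbrs` — a closed finite identity checked by `decide`/`native_decide`);
* `kernel_check` — all `980²` DP minima are `≥ 0` (blocks A–D + `checkBlock_sound`);
* **`sahiE_three_setInd_nonneg_prod3`**, **`sahiPositive_three_prodWeight₃`** — the theorem; `sahiPositive_three_prodWeight₃_linearOrder` —
  on the product of any three finite nonempty linear orders.
Statement in print: the three-dimensional case (all product measures, hence Lebesgue on `[0,1]³` by [LiebSahi2022, Lemma 2.3]) of Sahi's
conjecture [Sahi2008, Conj. 5]; [LiebSahi2022] prove dimension two; Gladkov (arXiv:2408.08457, Rem. 8.8): "still a conjecture".  Memo: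
prim-l12/FROM-prim-master-conj-g40-FULL-POLARISATION.md.
-/

namespace Summit.CriticalPhenomena.PercolationContinuityZ3.Theorems.SahiThreeChains

open Finset Literature.Combinatorics.Sahi2008

/-! ## The grid `[3]³`, the diagonal triple and the Latin orbit sum -/

/-- The grid `Q = [3]³`. [this work] -/
abbrev Q := Fin 3 × Fin 3 × Fin 3

/-- The diagonal triple `j ↦ (j,j,j)` of `Q`; `ρ · diag` runs over the 216 Latin triples as `ρ` runs over `Perm3`. [this work] -/
def diag : Trip (Fin 3) (Fin 3) (Fin 3) := fun j => (j, j, j)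

/-- The Latin triple `ρ · diag`: `j ↦ (ρ₁ j, ρ₂ j, ρ₃ j)`. [this work] -/
def dtrip (ρ : Perm3) : Trip (Fin 3) (Fin 3) (Fin 3) := actTrip ρ diag

/-- Components of `dtrip`. [this work] -/
theorem dtrip_apply (ρ : Perm3) (j : Fin 3) : dtrip ρ j = (ρ.1 j, ρ.2.1 j, ρ.2.2 j) := rfl

/-- The Latin orbit sum `Σ_ρ G_{abc}(ρ · diag)` of three subsets of the grid. [this work] -/
noncomputable def latinSum (a b c : Finset Q) : ℝ := ∑ ρ : Perm3, Gfun a b c (dtrip ρ)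

/-! ## Sorting pull-back -/

section Pull

variable {m₁ m₂ m₃ : ℕ}

/-- The sorted coordinate maps of a triple: `ψ(i,j,k) = (i-th smallest first coordinate, j-th smallest second, k-th smallest third)`. [this work] -/
def psi (t : Trip (Fin m₁) (Fin m₂) (Fin m₃)) (q : Q) : Fin m₁ × Fin m₂ × Fin m₃ :=
  ((t (Tuple.sort (fun j => (t j).1) q.1)).1, (t (Tuple.sort (fun j => (t j).2.1) q.2.1)).2.1,
    (t (Tuple.sort (fun j => (t j).2.2) q.2.2)).2.2)

/-- `ψ` is monotone. [this work] -/
theorem psi_monotone (t : Trip (Fin m₁) (Fin m₂) (Fin m₃)) : Monotone (psi t) := by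
  intro q q' h
  have h1 := Tuple.monotone_sort (fun j => (t j).1) h.1
  have h2 := Tuple.monotone_sort (fun j => (t j).2.1) h.2.1
  have h3 := Tuple.monotone_sort (fun j => (t j).2.2) h.2.2
  exact ⟨h1, h2, h3⟩

/-- The pull-back of a subset along `ψ`. [this work] -/
def pull (t : Trip (Fin m₁) (Fin m₂) (Fin m₃)) (s : Finset (Fin m₁ × Fin m₂ × Fin m₃)) : Finset Q :=
  univ.filter fun q => psi t q ∈ s

/-- The pull-back of an up-set is an up-set of the grid. [this work] -/
theorem isUpperSet_pull (t : Trip (Fin m₁) (Fin m₂) (Fin m₃)) {s : Finset (Fin m₁ × Fin m₂ × Fin m₃)}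
    (hs : IsUpperSet (s : Set (Fin m₁ × Fin m₂ × Fin m₃))) : IsUpperSet ((pull t s : Finset Q) : Set Q) := by
  intro q q' hqq' hq
  rw [Finset.mem_coe, pull, mem_filter] at hq ⊢
  exact ⟨mem_univ _, hs (psi_monotone t hqq') hq.2⟩

/-- Indicators pull back: `χ_s(ψ q) = χ_{pull s}(q)`. [this work] -/
theorem chi_psi (t : Trip (Fin m₁) (Fin m₂) (Fin m₃)) (s : Finset (Fin m₁ × Fin m₂ × Fin m₃)) (q : Q) :
    chi s (psi t q) = chi (pull t s) q := by
  simp [chi, pull]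

/-- **Orbit sums are Latin sums of the pulled-back triple.** [this work] -/
theorem orbitSum_eq_latinSum (t : Trip (Fin m₁) (Fin m₂) (Fin m₃)) (a b c : Finset (Fin m₁ × Fin m₂ × Fin m₃)) :
    ∑ π : Perm3, Gfun a b c (actTrip π t) = latinSum (pull t a) (pull t b) (pull t c) := by
  set σ : Perm3 := (Tuple.sort (fun j => (t j).1), Tuple.sort (fun j => (t j).2.1), Tuple.sort (fun j => (t j).2.2)) with hσ
  rw [latinSum, ← Equiv.sum_comp (Equiv.mulLeft σ)]
  refine sum_congr rfl fun ρ _ => ?_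
  have hact : actTrip (σ * ρ) t = fun j => psi t (actTrip ρ diag j) := by
    funext j
    simp [actTrip, psi, diag, hσ, Equiv.Perm.mul_apply]
  rw [Equiv.coe_mulLeft, dtrip, hact]
  simp only [Gfun, chi_psi]

end Pull

/-! ## Encoding subsets of the grid as bitmasks -/

/-- The code of a cell: `(i,j,k) ↦ i + 3j + 9k`. [this work] -/
def code (q : Q) : ℕ := q.1 + 3 * q.2.1 + 9 * q.2.2

/-- The cell of a code `u` (junk beyond `27`, by reduction mod `3`). [this work] -/
def cell (u : ℕ) : Q := (⟨u % 3, Nat.mod_lt _ (by decide)⟩, ⟨u / 3 % 3, Nat.mod_lt _ (by decide)⟩, ⟨u / 9 % 3, Nat.mod_lt _ (by decide)⟩)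

/-- `code q < 27`. [this work] -/
theorem code_lt (q : Q) : code q < 27 := by
  unfold code; have := q.1.isLt; have := q.2.1.isLt; have := q.2.2.isLt; omega

/-- `cell (code q) = q`. [this work] -/
theorem cell_code (q : Q) : cell (code q) = q := by
  obtain ⟨⟨i, hi⟩, ⟨j, hj⟩, ⟨k, hk⟩⟩ := q
  simp only [cell, code, Prod.mk.injEq, Fin.mk.injEq]
  refine ⟨by omega, by omega, by omega⟩

/-- `code (cell u) = u` for `u < 27`. [this work] -/
theorem code_cell {u : ℕ} (hu : u < 27) : code (cell u) = u := by
  simp only [cell, code]; omega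

/-- `code` is injective. [this work] -/
theorem code_injective : Function.Injective code := fun q q' h => by
  rw [← cell_code q, ← cell_code q', h]

/-- Bitmask of a list of bit positions. [this work] -/
def maskOfList (L : List ℕ) : ℕ := L.foldr (fun u acc => 2 ^ u ||| acc) 0

/-- Bits of `maskOfList`. [this work] -/
theorem testBit_maskOfList (L : List ℕ) (v : ℕ) : (maskOfList L).testBit v = decide (v ∈ L) := by
  induction L with
  | nil => simp [maskOfList]
  | cons u L ih =>
    have hcons : maskOfList (u :: L) = 2 ^ u ||| maskOfList L := rfl
    rw [hcons, Nat.testBit_lor, Nat.testBit_two_pow, ih]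
    by_cases h : u = v
    · subst h; simp
    · simp [h, Ne.symm h]

/-- The bitmask of a subset of the grid: bit `code q` is set iff `q ∈ s`. [this work] -/
def toMask (s : Finset Q) : ℕ := maskOfList ((List.range 27).filter fun u => cell u ∈ s)

/-- Bits of `toMask`. [this work] -/
theorem testBit_toMask (s : Finset Q) (u : ℕ) : (toMask s).testBit u = decide (u < 27 ∧ cell u ∈ s) := by
  rw [toMask, testBit_maskOfList]
  simp [List.mem_filter, List.mem_range]

/-- Bits of `toMask` at codes. [this work] -/
theorem testBit_toMask_code (s : Finset Q) (q : Q) : (toMask s).testBit (code q) = decide (q ∈ s) := by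
  rw [testBit_toMask, cell_code]
  simp [code_lt q]

/-- `toMask s < 2^27`. [this work] -/
theorem toMask_lt (s : Finset Q) : toMask s < 2 ^ 27 := by
  refine Nat.lt_pow_two_of_testBit _ fun i hi => ?_
  rw [testBit_toMask]
  simp only [decide_eq_false_iff_not, not_and]
  intro h; omega

/-- Order facts for successor codes. [this work] -/
theorem cell_le_cell_succ {u : ℕ} (h : u % 3 ≠ 2) : cell u ≤ cell (u + 1) := by
  refine ⟨?_, ?_, ?_⟩ <;> simp only [cell, Fin.mk_le_mk] <;> omega

/-- Order facts for successor codes. [this work] -/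
theorem cell_le_cell_add3 {u : ℕ} (h : u / 3 % 3 ≠ 2) : cell u ≤ cell (u + 3) := by
  refine ⟨?_, ?_, ?_⟩ <;> simp only [cell, Fin.mk_le_mk] <;> omega

/-- Order facts for successor codes. [this work] -/
theorem cell_le_cell_add9 {u : ℕ} (hu : u < 27) (h : u / 9 ≠ 2) : cell u ≤ cell (u + 9) := by
  refine ⟨?_, ?_, ?_⟩ <;> simp only [cell, Fin.mk_le_mk] <;> omega

/-- The bitmask of an up-set of the grid is `IsUp3`. [this work] -/
theorem isUp3_toMask {s : Finset Q} (hs : IsUpperSet ((s : Finset Q) : Set Q)) : IsUp3 (toMask s) := by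
  refine ⟨toMask_lt s, fun u hu hbit => ?_⟩
  rw [testBit_toMask, decide_eq_true_eq] at hbit
  refine ⟨fun h => ?_, fun h => ?_, fun h => ?_⟩
  · rw [testBit_toMask, decide_eq_true_eq]
    exact ⟨by omega, hs (cell_le_cell_succ h) hbit.2⟩
  · rw [testBit_toMask, decide_eq_true_eq]
    exact ⟨by omega, hs (cell_le_cell_add3 h) hbit.2⟩
  · rw [testBit_toMask, decide_eq_true_eq]
    exact ⟨by omega, hs (cell_le_cell_add9 hu h) hbit.2⟩

/-! ## The Latin orbit sum equals the kernel sum `Σ_{u ∈ ã} φ(code u)` -/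

/-- The fibre of Latin triples with a given first point. [this work] -/
def fib (u : Q) : Finset Perm3 := univ.filter fun ρ => dtrip ρ 0 = u

/-- FINITE FACT: the (second, third) points of the Latin triples with first point `u`, as codes, are exactly the Latin partners
`latinNbrs (code u)` of the kernel (as a multiset). [this work] -/
theorem fib_pairs : ∀ u : Q, ((fib u).val.map fun ρ => (code (dtrip ρ 1), code (dtrip ρ 2))) =
    (latinNbrs (code u) : Multiset (ℕ × ℕ)) := by
  native_decide

/-- FINITE FACT: every fibre has `8` elements. [this work] -/
theorem fib_card : ∀ u : Q, (fib u).card = 8 := by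
  native_decide

/-- Summing a function of the (second, third) codes over a fibre = summing it over the Latin partner list. [this work] -/
theorem sum_fib_eq_sum_latinNbrs (u : Q) (g : ℕ × ℕ → ℝ) :
    ∑ ρ ∈ fib u, g (code (dtrip ρ 1), code (dtrip ρ 2)) = ((latinNbrs (code u)).map g).sum := by
  rw [Finset.sum_eq_multiset_sum]
  change (Multiset.map (g ∘ fun ρ => (code (dtrip ρ 1), code (dtrip ρ 2))) (fib u).val).sum = _
  rw [← Multiset.map_map, fib_pairs u, Multiset.map_coe, Multiset.sum_coe]

/-- Position swap: summing `F(first, second)` over all Latin triples equals summing `F(second, first)`. [this work] -/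
theorem sum_dtrip_swap (F : Q → Q → ℝ) :
    ∑ ρ : Perm3, F (dtrip ρ 0) (dtrip ρ 1) = ∑ ρ : Perm3, F (dtrip ρ 1) (dtrip ρ 0) := by
  set τ : Equiv.Perm (Fin 3) := Equiv.swap 0 1 with hτ
  rw [← Equiv.sum_comp (Equiv.mulRight ((τ, τ, τ) : Perm3)) (fun ρ => F (dtrip ρ 0) (dtrip ρ 1))]
  refine sum_congr rfl fun ρ _ => ?_
  have h0 : dtrip (ρ * (τ, τ, τ)) 0 = dtrip ρ 1 := by
    simp [dtrip_apply, hτ, Equiv.Perm.mul_apply, Equiv.swap_apply_left]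
  have h1 : dtrip (ρ * (τ, τ, τ)) 1 = dtrip ρ 0 := by
    simp [dtrip_apply, hτ, Equiv.Perm.mul_apply, Equiv.swap_apply_right]
  simp only [Equiv.coe_mulRight, h0, h1]

/-- Boolean to real. [this work] -/
def b2R (b : Bool) : ℝ := if b then 1 else 0

/-- Cast of `b2i`. [this work] -/
theorem cast_b2i (b : Bool) : ((b2i b : ℤ) : ℝ) = b2R b := by
  cases b <;> simp [b2i, b2R]

/-- `b2R` of a conjunction. [this work] -/
theorem b2R_and (p q : Bool) : b2R (p && q) = b2R p * b2R q := by
  cases p <;> cases q <;> simp [b2R]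

/-- Indicators of the grid through the bitmask. [this work] -/
theorem b2R_testBit_toMask_code (s : Finset Q) (q : Q) : b2R ((toMask s).testBit (code q)) = chi s q := by
  rw [testBit_toMask_code]
  by_cases h : q ∈ s <;> simp [b2R, chi, h]

/-- The `B,C`-part of `G` at a Latin triple with first point `u`, in kernel form. [this work] -/
theorem inner_eq_phi (b c : Finset Q) (u : Q) :
    ∑ ρ ∈ fib u, (2 * (chi b u * chi c u) - chi b (dtrip ρ 1) * chi c (dtrip ρ 1) - chi c u * chi b (dtrip ρ 1)
        - chi b u * chi c (dtrip ρ 1) + chi b (dtrip ρ 1) * chi c (dtrip ρ 2)) =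
      ((phi (toMask b) (toMask c) (code u) : ℤ) : ℝ) := by
  set B := toMask b with hB
  set C := toMask c with hC
  -- the kernel side
  have hphi : ((phi B C (code u) : ℤ) : ℝ) = 16 * b2R (B.testBit (code u) && C.testBit (code u)) -
      ((latinNbrs (code u)).map fun p : ℕ × ℕ => b2R (B.testBit p.1 && C.testBit p.1) + b2R (C.testBit (code u) && B.testBit p.1)
        + b2R (B.testBit (code u) && C.testBit p.1) - b2R (B.testBit p.1 && C.testBit p.2)).sum := by
    have htab : latinTab.getD (code u) [] = latinNbrs (code u) := by
      unfold latinTab; exact getD_map_range _ _ (code_lt u)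
    simp only [phi, htab]
    push_cast
    simp only [cast_b2i]
    have hmap : (latinNbrs (code u)).map (Int.cast ∘ fun p : ℕ × ℕ =>
        b2i (B.testBit p.1 && C.testBit p.1) + b2i (C.testBit (code u) && B.testBit p.1) +
          b2i (B.testBit (code u) && C.testBit p.1) - b2i (B.testBit p.1 && C.testBit p.2)) =
        (latinNbrs (code u)).map (fun p : ℕ × ℕ => b2R (B.testBit p.1 && C.testBit p.1) + b2R (C.testBit (code u) && B.testBit p.1)
          + b2R (B.testBit (code u) && C.testBit p.1) - b2R (B.testBit p.1 && C.testBit p.2)) :=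
      List.map_congr_left fun p _ => by
        simp only [Function.comp_apply]
        push_cast
        simp only [cast_b2i]
    rw [List.map_map, hmap]
  rw [hphi, ← sum_fib_eq_sum_latinNbrs]
  -- now both sides are sums over the fibre; rewrite the bits at codes as indicators
  simp only [b2R_and, hB, hC, b2R_testBit_toMask_code]
  rw [Finset.sum_add_distrib, Finset.sum_sub_distrib, Finset.sum_sub_distrib, Finset.sum_sub_distrib, Finset.sum_const, fib_card,
    nsmul_eq_mul]
  push_cast
  simp only [Finset.sum_add_distrib, Finset.sum_sub_distrib]
  ring

/-- **The Latin orbit sum is the kernel sum**: `Σ_ρ G_{ãb̃c̃}(ρ·diag) = Σ_{u ∈ ã} φ_{toMask b̃, toMask c̃}(code u)`. [this work] -/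
theorem latinSum_eq_sum_phi (a b c : Finset Q) :
    latinSum a b c = ∑ u ∈ a, ((phi (toMask b) (toMask c) (code u) : ℤ) : ℝ) := by
  -- Step 1: bring `a` to the first point in every term
  have h3 : ∑ ρ : Perm3, chi b (dtrip ρ 0) * (chi a (dtrip ρ 1) * chi c (dtrip ρ 1)) =
      ∑ ρ : Perm3, chi a (dtrip ρ 0) * (chi c (dtrip ρ 0) * chi b (dtrip ρ 1)) := by
    rw [sum_dtrip_swap (fun x y => chi b x * (chi a y * chi c y))]
    exact sum_congr rfl fun ρ _ => by ring
  have h4 : ∑ ρ : Perm3, chi c (dtrip ρ 0) * (chi a (dtrip ρ 1) * chi b (dtrip ρ 1)) =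
      ∑ ρ : Perm3, chi a (dtrip ρ 0) * (chi b (dtrip ρ 0) * chi c (dtrip ρ 1)) := by
    rw [sum_dtrip_swap (fun x y => chi c x * (chi a y * chi b y))]
    exact sum_congr rfl fun ρ _ => by ring
  have step1 : latinSum a b c = ∑ ρ : Perm3, chi a (dtrip ρ 0) *
      (2 * (chi b (dtrip ρ 0) * chi c (dtrip ρ 0)) - chi b (dtrip ρ 1) * chi c (dtrip ρ 1)
        - chi c (dtrip ρ 0) * chi b (dtrip ρ 1) - chi b (dtrip ρ 0) * chi c (dtrip ρ 1) + chi b (dtrip ρ 1) * chi c (dtrip ρ 2)) := by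
    unfold latinSum
    simp only [Gfun]
    have hterm : ∀ ρ : Perm3, 2 * (chi a (dtrip ρ 0) * chi b (dtrip ρ 0) * chi c (dtrip ρ 0))
        - chi a (dtrip ρ 0) * (chi b (dtrip ρ 1) * chi c (dtrip ρ 1)) - chi b (dtrip ρ 0) * (chi a (dtrip ρ 1) * chi c (dtrip ρ 1))
        - chi c (dtrip ρ 0) * (chi a (dtrip ρ 1) * chi b (dtrip ρ 1)) + chi a (dtrip ρ 0) * chi b (dtrip ρ 1) * chi c (dtrip ρ 2) =
        (2 * (chi a (dtrip ρ 0) * chi b (dtrip ρ 0) * chi c (dtrip ρ 0))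
        - chi a (dtrip ρ 0) * (chi b (dtrip ρ 1) * chi c (dtrip ρ 1)) + chi a (dtrip ρ 0) * chi b (dtrip ρ 1) * chi c (dtrip ρ 2))
        - chi b (dtrip ρ 0) * (chi a (dtrip ρ 1) * chi c (dtrip ρ 1))
        - chi c (dtrip ρ 0) * (chi a (dtrip ρ 1) * chi b (dtrip ρ 1)) := fun ρ => by ring
    rw [sum_congr rfl fun ρ _ => hterm ρ, Finset.sum_sub_distrib, Finset.sum_sub_distrib, h3, h4, ← Finset.sum_sub_distrib,
      ← Finset.sum_sub_distrib]
    exact sum_congr rfl fun ρ _ => by ring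
  rw [step1]
  -- Step 2: group by the first point
  rw [← Finset.sum_fiberwise (Finset.univ : Finset Perm3) (fun ρ => dtrip ρ 0)]
  -- Step 3: on the fibre over `u`, the first point is `u`
  have step3 : ∀ u : Q, ∑ ρ ∈ Finset.univ.filter (fun ρ => dtrip ρ 0 = u), chi a (dtrip ρ 0) *
      (2 * (chi b (dtrip ρ 0) * chi c (dtrip ρ 0)) - chi b (dtrip ρ 1) * chi c (dtrip ρ 1)
        - chi c (dtrip ρ 0) * chi b (dtrip ρ 1) - chi b (dtrip ρ 0) * chi c (dtrip ρ 1) + chi b (dtrip ρ 1) * chi c (dtrip ρ 2)) =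
      chi a u * ((phi (toMask b) (toMask c) (code u) : ℤ) : ℝ) := by
    intro u
    rw [← inner_eq_phi, Finset.mul_sum]
    refine sum_congr rfl fun ρ hρ => ?_
    rw [fib, mem_filter] at hρ
    rw [hρ.2]
  rw [sum_congr rfl fun u _ => step3 u]
  -- Step 4: `χ_a(u) · P(u)` summed over all `u` is the sum over `u ∈ a`
  rw [← Finset.sum_filter_add_sum_filter_not univ (fun u => u ∈ a)]
  have hin : ∑ u ∈ univ.filter (fun u => u ∈ a), chi a u * ((phi (toMask b) (toMask c) (code u) : ℤ) : ℝ) =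
      ∑ u ∈ a, ((phi (toMask b) (toMask c) (code u) : ℤ) : ℝ) := by
    rw [Finset.filter_univ_mem]
    exact sum_congr rfl fun u hu => by simp [chi, hu]
  have hout : ∑ u ∈ univ.filter (fun u => ¬ u ∈ a), chi a u * ((phi (toMask b) (toMask c) (code u) : ℤ) : ℝ) = 0 :=
    sum_eq_zero fun u hu => by
      rw [mem_filter] at hu
      simp [chi, hu.2]
  rw [hin, hout, add_zero]

/-! ## Assembly -/

/-- All `980²` DP minima of the three-chains check are nonnegative (blocks A–D). [this work] -/
theorem kernel_check (b c : ℕ) (hb : b < 980) (hc : c < 980) : 0 ≤ minUp3 (phiTab (ups3.getD b 0) (ups3.getD c 0)) := by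
  rcases Nat.lt_or_ge b 245 with h1 | h1
  · exact checkBlock_sound checkBlock_A (Nat.zero_le _) h1 hc
  rcases Nat.lt_or_ge b 490 with h2 | h2
  · exact checkBlock_sound checkBlock_B h1 h2 hc
  rcases Nat.lt_or_ge b 735 with h3 | h3
  · exact checkBlock_sound checkBlock_C h2 h3 hc
  · exact checkBlock_sound checkBlock_D h3 hb hc

/-- **The combinatorial kernel `κ₃ ≥ 0`**: the Latin orbit sum of three up-sets of the grid `[3]³` is nonnegative. [this work] -/
theorem latinSum_nonneg {a b c : Finset Q} (ha : IsUpperSet ((a : Finset Q) : Set Q)) (hb : IsUpperSet ((b : Finset Q) : Set Q))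
    (hc : IsUpperSet ((c : Finset Q) : Set Q)) : 0 ≤ latinSum a b c := by
  rw [latinSum_eq_sum_phi]
  have h := sum_phi_nonneg_of_check' kernel_check (isUp3_toMask ha) (isUp3_toMask hb) (isUp3_toMask hc)
  have hset : ∑ u ∈ (Finset.range 27).filter (fun u => (toMask a).testBit u = true), phi (toMask b) (toMask c) u =
      ∑ u ∈ a, phi (toMask b) (toMask c) (code u) := by
    rw [← Finset.sum_image (f := fun u => phi (toMask b) (toMask c) u) (fun x _ y _ h => code_injective h)]
    refine sum_congr ?_ fun _ _ => rfl
    ext u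
    simp only [mem_filter, mem_range, mem_image, testBit_toMask, decide_eq_true_eq]
    constructor
    · rintro ⟨hu, -, hq⟩
      exact ⟨cell u, hq, code_cell hu⟩
    · rintro ⟨q, hq, rfl⟩
      exact ⟨code_lt q, code_lt q, by rw [cell_code]; exact hq⟩
  rw [hset] at h
  exact_mod_cast h

section Main

variable {m₁ m₂ m₃ : ℕ}

/-- **Sahi's `E₃ ≥ 0` for three up-sets of a product of three finite chains, every product probability weight.** [this work] -/
theorem sahiE_three_setInd_nonneg_prod3 {w₁ : Fin m₁ → ℝ} {w₂ : Fin m₂ → ℝ} {w₃ : Fin m₃ → ℝ} (h₁ : ∀ x, 0 ≤ w₁ x)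
    (h₂ : ∀ y, 0 ≤ w₂ y) (h₃ : ∀ z, 0 ≤ w₃ z) (hμ : ∑ p, prodW w₁ w₂ w₃ p = 1)
    {a b c : Finset (Fin m₁ × Fin m₂ × Fin m₃)} (ha : IsUpperSet ((a : Finset _) : Set (Fin m₁ × Fin m₂ × Fin m₃)))
    (hb : IsUpperSet ((b : Finset _) : Set (Fin m₁ × Fin m₂ × Fin m₃))) (hc : IsUpperSet ((c : Finset _) : Set (Fin m₁ × Fin m₂ × Fin m₃))) :
    0 ≤ sahiE (prodW w₁ w₂ w₃) 3 ![setInd a, setInd b, setInd c] :=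
  sahiE_three_setInd_nonneg_of_orbitSum_nonneg h₁ h₂ h₃ hμ a b c fun t => by
    rw [orbitSum_eq_latinSum]
    exact latinSum_nonneg (isUpperSet_pull t ha) (isUpperSet_pull t hb) (isUpperSet_pull t hc)

/-- **THEOREM (Sahi positivity of order 3 on a product of three finite chains).**  For ALL probability weights `w₁, w₂, w₃` on
`Fin m₁, Fin m₂, Fin m₃`, the product weight is Sahi-positive of order `3`: `E₃(f,g,h) ≥ 0` for all nonnegative monotone `f, g, h`
— the three-dimensional case of Sahi's conjecture [Sahi2008, Conj. 5] for product measures (dimension two: [LiebSahi2022, Thm. 3.7]).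
Computer-assisted: full polarisation (`…BridgePolar`) + the finite kernel check of `[3]³` (`…Cert`, blocks A–D). [this work] -/
theorem sahiPositive_three_prodWeight₃ (w₁ : Fin m₁ → ℝ) (w₂ : Fin m₂ → ℝ) (w₃ : Fin m₃ → ℝ) (h₁ : ∀ x, 0 ≤ w₁ x)
    (h₂ : ∀ y, 0 ≤ w₂ y) (h₃ : ∀ z, 0 ≤ w₃ z) (hμ : ∑ p, prodW w₁ w₂ w₃ p = 1) :
    SahiPositive (prodW w₁ w₂ w₃) 3 := by
  rw [sahiPositive_iff_indicators]
  intro U hU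
  have hf : (fun i => setInd (U i)) = ![setInd (U 0), setInd (U 1), setInd (U 2)] := by
    funext i; fin_cases i <;> rfl
  rw [hf]
  exact sahiE_three_setInd_nonneg_prod3 h₁ h₂ h₃ hμ (hU 0) (hU 1) (hU 2)

/-- The product of three probability weights has total mass one. [this work] -/
theorem sum_prodW_eq_one {w₁ : Fin m₁ → ℝ} {w₂ : Fin m₂ → ℝ} {w₃ : Fin m₃ → ℝ} (hw₁ : ∑ x, w₁ x = 1) (hw₂ : ∑ y, w₂ y = 1)
    (hw₃ : ∑ z, w₃ z = 1) : ∑ p, prodW w₁ w₂ w₃ p = 1 := by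
  have h3 : ∀ a b, ∑ c, w₁ a * w₂ b * w₃ c = w₁ a * w₂ b := fun a b => by rw [← Finset.mul_sum, hw₃, mul_one]
  have h2 : ∀ a, ∑ b, w₁ a * w₂ b = w₁ a := fun a => by rw [← Finset.mul_sum, hw₂, mul_one]
  simp only [prodW, Fintype.sum_prod_type, h3, h2, hw₁]

/-- **THEOREM, marginal form.**  For probability weights `w₁, w₂, w₃` (nonnegative, each of total mass one) on three finite chains
`Fin m₁, Fin m₂, Fin m₃`, the product weight `p ↦ w₁ p.1 · w₂ p.2.1 · w₃ p.2.2` is Sahi-positive of order `3`. [this work] -/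
theorem sahiPositive_three_prodWeight₃' (w₁ : Fin m₁ → ℝ) (w₂ : Fin m₂ → ℝ) (w₃ : Fin m₃ → ℝ) (h₁ : ∀ x, 0 ≤ w₁ x)
    (h₂ : ∀ y, 0 ≤ w₂ y) (h₃ : ∀ z, 0 ≤ w₃ z) (hw₁ : ∑ x, w₁ x = 1) (hw₂ : ∑ y, w₂ y = 1) (hw₃ : ∑ z, w₃ z = 1) :
    SahiPositive (fun p : Fin m₁ × Fin m₂ × Fin m₃ => w₁ p.1 * w₂ p.2.1 * w₃ p.2.2) 3 :=
  sahiPositive_three_prodWeight₃ w₁ w₂ w₃ h₁ h₂ h₃ (sum_prodW_eq_one hw₁ hw₂ hw₃)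

end Main

end Summit.CriticalPhenomena.PercolationContinuityZ3.Theorems.SahiThreeChains
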